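import Literature.RepresentationTheory.KonnoKonno2007.RealUnitaryDualPair
import Literature.RepresentationTheory.KonnoKonno2007.JunctionVacuumCirclePin
import Literature.LinearAlgebra.Matrix.RotationThreeShears
import HarnessLib

/-!
# The `SU(1,1)` of a hyperbolic plane of the real unitary dual pair, in a Siegel frame

Group-side data for the junction zero-point pin (`JunctionVacuumCirclePin`,
`RealDualPairJunction.FockVacuumCharacter.two_mul_zmul_eP_sub_eQ_eq_neg_trace_of_absorb`) over the INSTANCE
`RealDualPair.junction P Q R S : RealDualPairJunction P Q R S (U(P,Q) × U(R,S))` of `RealUnitaryDualPair`.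

Fix a hyperbolic plane `ℂ e_{p₀} ⊕ ℂ e_{q₀} ⊂ V = ℂ^{P ⊕ Q}` of the diagonal hermitian form `diag(1_P, −1_Q)`
(`p₀ ∈ P`, `q₀ ∈ Q`).  This file constructs, by explicit matrices,

* `RealDualPair.cay g = ½ · C′ g C′ᴴ`, `C′ = !![1, i; i, 1]` — the Cayley conjugate carrying `SL(2,ℝ)` into
  `SU(1,1) = {m : mᴴ diag(1,−1) m = diag(1,−1)}`, with `cay (R θ) = diag(e^{iθ}, e^{−iθ})`
  (`cay_rot_*`) and the `SU(1,1)` relations `cay_rel₁ … cay_rel₄`;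
* `RealDualPair.plant p₀ q₀ m` — the matrix of `V` equal to `m` on the plane `{e_{p₀}, e_{q₀}}` and to `1` off it —
  and the homomorphism **`RealDualPair.φ R S p₀ q₀ : SL(2,ℝ) →* U(P,Q) × U(R,S)`**, `g ↦ (plant (cay g), 1)`;
* **`φ_slRot`** : `φ (R θ) = κ (suCircle p₀ q₀ θ)` — the compact circle of this `SU(1,1)` is the `K_V`-circle
  `((e^{iθ} at p₀, e^{−iθ} at q₀), (1, 1))` of `JunctionVacuumCirclePin` (orientation `η = 1`);
* the **Siegel frame** `RealDualPair.frame R S p₀ q₀ ∈ U(DPIdx P Q R S)` (`frameU`, inverse `frameAdj = uᴴ`):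
  a `√2`-free unitary with entries in `ℤ[i]/2`, acting on each pair of complex coordinates `{(p₀, w), (q₀, w)}`
  of `𝕎 = V ⊗ W`, `w ∈ R ⊕ S`, by `½·!![1+i, −(1+i); 1−i, 1−i]` (`w ∈ R`) resp. `½·!![1+i, 1+i; 1−i, −(1−i)]`
  (`w ∈ S`), and by `1` on all other coordinates (it absorbs the complex conjugation `tw` of the same-sign
  blocks of `ι𝕎` and Cayley-rotates `SU(1,1)` back to a real `SL₂`); the diagonal maps `planeProj = Π`
  (indicator of the `2(|R|+|S|)` real plane coordinates) and `shearDir = b = Π_S − Π_R` with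
  `tr b = 2(|S| − |R|)` (`trace_toMatrix'_shearDir`);
* the frame identities: **`frame_ιφ_slLower`** — in the frame, `ι𝕎 (φ L(y))` is the Siegel unipotent
  `(p, q) ↦ (p, q + y·b p)`; **`frame_ιφ_slDiag_half`** — `ι𝕎 (φ D(½))` is `(p, q) ↦ (p − ½Πp, q + Πq)`;
  `b`, `Π` symmetric, `Π² = Π`, `bΠ = Πb = b`;
* the conclusion **`two_mul_eP_sub_eQ` / `eP_sub_eQ`**: for every vacuum character with exponents `e` over the
  junction (`(junction P Q R S).FockVacuumCharacter e`, the hypothesis record of `FockModelUnitaryDualPair`) and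
  every `p₀ ∈ P`, `q₀ ∈ Q`:  `e_P − e_Q = |R| − |S|` — the zero-point correlation of the two determinant powers
  (Kashiwara–Vergne / KK07 (3.1): `det^{(|R|−|S|)/2}` twisted against `det^{−(|R|−|S|)/2}` up to the common
  shift), obtained from zp2d §5 with `−tr b = 2(|R| − |S|)`.

Everything here is a kernel fact about explicit matrices (0 records, 0 `Prop` definitions); the only
hypothesis of the conclusion is the record `FockVacuumCharacter` itself.
-/

noncomputable section

open Matrix Complex
open scoped Kronecker ComplexConjugate
open Literature.Analysis.SegalBargmann Literature.RepresentationTheory.HeisenbergGroup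
open Literature.NumberTheory.Automorphic Literature.NumberTheory.Automorphic.UnitaryGroup
open Literature.LinearAlgebra.Matrix Literature.LinearAlgebra.Matrix.RotationThreeShears

namespace Literature.RepresentationTheory.KonnoKonno2007

namespace RealDualPair

/-! ## 0. Generic matrix lemmas -/

section Generic

variable {m n : Type*} [Fintype m] [Fintype n] [DecidableEq n]

/-- a square matrix is determined by its action on vectors. [folklore] -/
theorem matrix_eq_of_mulVec_eq [DecidableEq m] {A B : Matrix m m ℂ} (h : ∀ x, A *ᵥ x = B *ᵥ x) : A = B :=
  Matrix.toLin'.injective (LinearMap.ext fun x => by rw [Matrix.toLin'_apply, Matrix.toLin'_apply, h x])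

/-- `(A ⊗ 1) v` at `(i, w)` is `A` applied to the `w`-slice of `v`. [folklore] -/
theorem kronecker_one_mulVec (A : Matrix m m ℂ) (v : m × n → ℂ) (i : m) (w : n) :
    ((A ⊗ₖ (1 : Matrix n n ℂ)) *ᵥ v) (i, w) = (A *ᵥ fun j => v (j, w)) i := by
  simp only [mulVec, dotProduct, Fintype.sum_prod_type, kroneckerMap_apply, one_apply, mul_ite, mul_one,
    mul_zero, ite_mul, zero_mul, Finset.sum_ite_eq, Finset.mem_univ, if_true]

/-- `reindex e e M` acts on vectors by transport: `(reindex e e M) v = (M (v ∘ e)) ∘ e⁻¹`. [folklore] -/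
theorem reindex_mulVec {o : Type*} [Fintype o] (e : m ≃ o) (M : Matrix m m ℂ) (v : o → ℂ) :
    Matrix.reindex e e M *ᵥ v = (M *ᵥ (v ∘ e)) ∘ e.symm := by
  rw [Matrix.reindex_apply, Matrix.submatrix_mulVec_equiv, Equiv.symm_symm]

end Generic

/-! ## 1. The Cayley conjugate `SL(2,ℝ) → SU(1,1)` -/

section Cayley

/-- **The Cayley conjugate** `cay g = ½ · C′ g C′ᴴ`, `C′ = !![1, i; i, 1]`, written by entries: for
`g = !![a, b; c, d]`, `cay g = ½ · !![(a+d) + i(c−b), (b+c) + i(d−a); (b+c) + i(a−d), (a+d) + i(b−c)]`.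
It carries `SL(2,ℝ) = Sp(2,ℝ)` onto `SU(1,1)` (`C′ᴴ diag(1,−1) C′ = −2i·J`). [folklore] -/
def cay (g : Matrix (Fin 2) (Fin 2) ℝ) : Matrix (Fin 2) (Fin 2) ℂ :=
  !![(((g 0 0 + g 1 1) / 2 : ℝ) : ℂ) + (((g 1 0 - g 0 1) / 2 : ℝ) : ℂ) * I,
      (((g 0 1 + g 1 0) / 2 : ℝ) : ℂ) + (((g 1 1 - g 0 0) / 2 : ℝ) : ℂ) * I;
    (((g 0 1 + g 1 0) / 2 : ℝ) : ℂ) + (((g 0 0 - g 1 1) / 2 : ℝ) : ℂ) * I,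
      (((g 0 0 + g 1 1) / 2 : ℝ) : ℂ) + (((g 0 1 - g 1 0) / 2 : ℝ) : ℂ) * I]

/-- entry `(0,0)` of `cay g`. [folklore] -/
@[simp] theorem cay_apply_00 (g : Matrix (Fin 2) (Fin 2) ℝ) :
    cay g 0 0 = (((g 0 0 + g 1 1) / 2 : ℝ) : ℂ) + (((g 1 0 - g 0 1) / 2 : ℝ) : ℂ) * I := rfl

/-- entry `(0,1)` of `cay g`. [folklore] -/
@[simp] theorem cay_apply_01 (g : Matrix (Fin 2) (Fin 2) ℝ) :
    cay g 0 1 = (((g 0 1 + g 1 0) / 2 : ℝ) : ℂ) + (((g 1 1 - g 0 0) / 2 : ℝ) : ℂ) * I := rfl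

/-- entry `(1,0)` of `cay g`. [folklore] -/
@[simp] theorem cay_apply_10 (g : Matrix (Fin 2) (Fin 2) ℝ) :
    cay g 1 0 = (((g 0 1 + g 1 0) / 2 : ℝ) : ℂ) + (((g 0 0 - g 1 1) / 2 : ℝ) : ℂ) * I := rfl

/-- entry `(1,1)` of `cay g`. [folklore] -/
@[simp] theorem cay_apply_11 (g : Matrix (Fin 2) (Fin 2) ℝ) :
    cay g 1 1 = (((g 0 0 + g 1 1) / 2 : ℝ) : ℂ) + (((g 0 1 - g 1 0) / 2 : ℝ) : ℂ) * I := rfl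

/-- `cay` is multiplicative (it is a conjugation). [folklore] -/
theorem cay_mul (g h : Matrix (Fin 2) (Fin 2) ℝ) : cay (g * h) = cay g * cay h := by
  ext i j
  fin_cases i <;> fin_cases j <;> apply Complex.ext <;>
    simp [cay, Matrix.mul_apply, Fin.sum_univ_two] <;> ring

/-- `cay 1 = 1`. [folklore] -/
theorem cay_one : cay 1 = 1 := by
  ext i j
  fin_cases i <;> fin_cases j <;> apply Complex.ext <;> simp [cay]

/-- `SU(1,1)`-relation of `m = cay g`, `det g = 1`, column `0` against column `0`:
`m̄₀₀ m₀₀ − m̄₁₀ m₁₀ = 1`. [folklore] -/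
theorem cay_rel₁ (g : Matrix (Fin 2) (Fin 2) ℝ) (hg : g 0 0 * g 1 1 - g 0 1 * g 1 0 = 1) :
    star (cay g 0 0) * cay g 0 0 - star (cay g 1 0) * cay g 1 0 = 1 := by
  apply Complex.ext <;> simp [cay] <;> first | linear_combination hg | linear_combination (-1 : ℝ) * hg | ring

/-- `SU(1,1)`-relation, column `0` against column `1`: `m̄₀₀ m₀₁ − m̄₁₀ m₁₁ = 0` (identically in `g`). [folklore] -/
theorem cay_rel₂ (g : Matrix (Fin 2) (Fin 2) ℝ) :
    star (cay g 0 0) * cay g 0 1 - star (cay g 1 0) * cay g 1 1 = 0 := by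
  apply Complex.ext <;> simp [cay] <;> ring

/-- `SU(1,1)`-relation, column `1` against column `0`: `m̄₀₁ m₀₀ − m̄₁₁ m₁₀ = 0` (identically in `g`). [folklore] -/
theorem cay_rel₃ (g : Matrix (Fin 2) (Fin 2) ℝ) :
    star (cay g 0 1) * cay g 0 0 - star (cay g 1 1) * cay g 1 0 = 0 := by
  apply Complex.ext <;> simp [cay] <;> ring

/-- `SU(1,1)`-relation, column `1` against column `1`: `m̄₀₁ m₀₁ − m̄₁₁ m₁₁ = −1`. [folklore] -/
theorem cay_rel₄ (g : Matrix (Fin 2) (Fin 2) ℝ) (hg : g 0 0 * g 1 1 - g 0 1 * g 1 0 = 1) :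
    star (cay g 0 1) * cay g 0 1 - star (cay g 1 1) * cay g 1 1 = -1 := by
  apply Complex.ext <;> simp [cay] <;> first | linear_combination hg | linear_combination (-1 : ℝ) * hg | ring

/-- `cay (R θ)₀₀ = e^{iθ}`. [folklore] -/
theorem cay_rot_00 (θ : ℝ) : cay (rot θ) 0 0 = ((Circle.exp θ : Circle) : ℂ) := by
  rw [Circle.coe_exp, Complex.exp_mul_I]
  apply Complex.ext <;> simp [cay, rot, Complex.cos_ofReal_re, Complex.sin_ofReal_re,
    Complex.cos_ofReal_im, Complex.sin_ofReal_im]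

/-- `cay (R θ)₁₁ = e^{−iθ}`. [folklore] -/
theorem cay_rot_11 (θ : ℝ) : cay (rot θ) 1 1 = ((Circle.exp (-θ) : Circle) : ℂ) := by
  rw [Circle.coe_exp, Complex.exp_mul_I]
  apply Complex.ext <;> simp [cay, rot, Complex.cos_ofReal_re, Complex.sin_ofReal_re,
    Complex.cos_ofReal_im, Complex.sin_ofReal_im]
  ring

/-- `cay (R θ)₀₁ = 0`. [folklore] -/
theorem cay_rot_01 (θ : ℝ) : cay (rot θ) 0 1 = 0 := by
  apply Complex.ext <;> simp [cay, rot]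

/-- `cay (R θ)₁₀ = 0`. [folklore] -/
theorem cay_rot_10 (θ : ℝ) : cay (rot θ) 1 0 = 0 := by
  apply Complex.ext <;> simp [cay, rot]

/-- `cay` on `SL(2,ℝ)` as a monoid homomorphism into `2 × 2` complex matrices. [folklore] -/
def cayHom : Matrix.SpecialLinearGroup (Fin 2) ℝ →* Matrix (Fin 2) (Fin 2) ℂ where
  toFun g := cay (g : Matrix (Fin 2) (Fin 2) ℝ)
  map_one' := by simp only [Matrix.SpecialLinearGroup.coe_one, cay_one]
  map_mul' g h := by simp only [Matrix.SpecialLinearGroup.coe_mul, cay_mul]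

/-- unfolding `cayHom`. [folklore] -/
@[simp] theorem cayHom_apply (g : Matrix.SpecialLinearGroup (Fin 2) ℝ) :
    cayHom g = cay (g : Matrix (Fin 2) (Fin 2) ℝ) := rfl

/-- the determinant-one relation of `g ∈ SL(2,ℝ)` by entries. [folklore] -/
theorem sl2_det_entries (g : Matrix.SpecialLinearGroup (Fin 2) ℝ) :
    (g : Matrix (Fin 2) (Fin 2) ℝ) 0 0 * (g : Matrix (Fin 2) (Fin 2) ℝ) 1 1 -
      (g : Matrix (Fin 2) (Fin 2) ℝ) 0 1 * (g : Matrix (Fin 2) (Fin 2) ℝ) 1 0 = 1 := by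
  rw [← Matrix.det_fin_two]
  exact g.det_coe

end Cayley

/-! ## 2. Planting a `2 × 2` matrix on the plane `{e_{p₀}, e_{q₀}}` of `V = ℂ^{P ⊕ Q}` -/

section Plant

variable {P Q : Type*} [Fintype P] [DecidableEq P] [Fintype Q] [DecidableEq Q] (p₀ : P) (q₀ : Q)

/-- **`plant p₀ q₀ m`**: the matrix of `V = ℂ^{P ⊕ Q}` which is `m` on the plane spanned by `e_{p₀}` (index
`inl p₀`, coordinate `0` of `m`) and `e_{q₀}` (index `inr q₀`, coordinate `1` of `m`), and the identity on all
other basis vectors. [folklore] -/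
def plant (m : Matrix (Fin 2) (Fin 2) ℂ) : Matrix (P ⊕ Q) (P ⊕ Q) ℂ :=
  Matrix.of fun i j =>
    match i, j with
    | Sum.inl p, Sum.inl p' => if p = p₀ then (if p' = p₀ then m 0 0 else 0) else (if p' = p then 1 else 0)
    | Sum.inl p, Sum.inr q' => if p = p₀ ∧ q' = q₀ then m 0 1 else 0
    | Sum.inr q, Sum.inl p' => if q = q₀ ∧ p' = p₀ then m 1 0 else 0
    | Sum.inr q, Sum.inr q' => if q = q₀ then (if q' = q₀ then m 1 1 else 0) else (if q' = q then 1 else 0)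

omit [Fintype P] [Fintype Q] in
/-- entries of `plant`. [folklore] -/
@[simp] theorem plant_inl_inl (m : Matrix (Fin 2) (Fin 2) ℂ) (p p' : P) :
    plant p₀ q₀ m (Sum.inl p) (Sum.inl p') =
      if p = p₀ then (if p' = p₀ then m 0 0 else 0) else (if p' = p then 1 else 0) := rfl

omit [Fintype P] [Fintype Q] in
/-- entries of `plant`. [folklore] -/
@[simp] theorem plant_inl_inr (m : Matrix (Fin 2) (Fin 2) ℂ) (p : P) (q' : Q) :
    plant p₀ q₀ m (Sum.inl p) (Sum.inr q') = if p = p₀ ∧ q' = q₀ then m 0 1 else 0 := rfl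

omit [Fintype P] [Fintype Q] in
/-- entries of `plant`. [folklore] -/
@[simp] theorem plant_inr_inl (m : Matrix (Fin 2) (Fin 2) ℂ) (q : Q) (p' : P) :
    plant p₀ q₀ m (Sum.inr q) (Sum.inl p') = if q = q₀ ∧ p' = p₀ then m 1 0 else 0 := rfl

omit [Fintype P] [Fintype Q] in
/-- entries of `plant`. [folklore] -/
@[simp] theorem plant_inr_inr (m : Matrix (Fin 2) (Fin 2) ℂ) (q q' : Q) :
    plant p₀ q₀ m (Sum.inr q) (Sum.inr q') =
      if q = q₀ then (if q' = q₀ then m 1 1 else 0) else (if q' = q then 1 else 0) := rfl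

/-- `plant m` on vectors, `V⁺`-coordinates: `m`'s first row on the plane, identity off it. [folklore] -/
theorem plant_mulVec_inl (m : Matrix (Fin 2) (Fin 2) ℂ) (x : P ⊕ Q → ℂ) (p : P) :
    (plant p₀ q₀ m *ᵥ x) (Sum.inl p) =
      if p = p₀ then m 0 0 * x (Sum.inl p₀) + m 0 1 * x (Sum.inr q₀) else x (Sum.inl p) := by
  simp only [mulVec, dotProduct, Fintype.sum_sum_type, plant_inl_inl, plant_inl_inr]
  by_cases hp : p = p₀
  · simp [hp, ite_mul]
  · simp [hp, ite_mul]

/-- `plant m` on vectors, `V⁻`-coordinates. [folklore] -/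
theorem plant_mulVec_inr (m : Matrix (Fin 2) (Fin 2) ℂ) (x : P ⊕ Q → ℂ) (q : Q) :
    (plant p₀ q₀ m *ᵥ x) (Sum.inr q) =
      if q = q₀ then m 1 0 * x (Sum.inl p₀) + m 1 1 * x (Sum.inr q₀) else x (Sum.inr q) := by
  simp only [mulVec, dotProduct, Fintype.sum_sum_type, plant_inr_inl, plant_inr_inr]
  by_cases hq : q = q₀
  · simp [hq, ite_mul]
  · simp [hq, ite_mul]

/-- `plant` is multiplicative. [folklore] -/
theorem plant_mul (m m' : Matrix (Fin 2) (Fin 2) ℂ) :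
    plant p₀ q₀ (m * m') = plant p₀ q₀ m * plant p₀ q₀ m' := by
  refine matrix_eq_of_mulVec_eq fun x => ?_
  rw [← mulVec_mulVec]
  funext i
  rcases i with p | q
  · rw [plant_mulVec_inl, plant_mulVec_inl]
    by_cases hp : p = p₀
    · rw [if_pos hp, if_pos hp, plant_mulVec_inl, plant_mulVec_inr, if_pos rfl, if_pos rfl]
      simp only [Matrix.mul_apply, Fin.sum_univ_two]
      ring
    · rw [if_neg hp, if_neg hp, plant_mulVec_inl, if_neg hp]
  · rw [plant_mulVec_inr, plant_mulVec_inr]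
    by_cases hq : q = q₀
    · rw [if_pos hq, if_pos hq, plant_mulVec_inl, plant_mulVec_inr, if_pos rfl, if_pos rfl]
      simp only [Matrix.mul_apply, Fin.sum_univ_two]
      ring
    · rw [if_neg hq, if_neg hq, plant_mulVec_inr, if_neg hq]

/-- `plant 1 = 1`. [folklore] -/
theorem plant_one : plant p₀ q₀ (1 : Matrix (Fin 2) (Fin 2) ℂ) = 1 := by
  refine matrix_eq_of_mulVec_eq fun x => ?_
  rw [one_mulVec]
  funext i
  rcases i with p | q
  · rw [plant_mulVec_inl]
    by_cases hp : p = p₀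
    · rw [if_pos hp, hp]; simp
    · rw [if_neg hp]
  · rw [plant_mulVec_inr]
    by_cases hq : q = q₀
    · rw [if_pos hq, hq]; simp
    · rw [if_neg hq]

omit [Fintype P] [Fintype Q] in
/-- `plant` commutes with the conjugate transpose. [folklore] -/
theorem plant_conjTranspose (m : Matrix (Fin 2) (Fin 2) ℂ) : (plant p₀ q₀ m)ᴴ = plant p₀ q₀ mᴴ := by
  ext i j
  rcases i with p | q <;> rcases j with p' | q' <;>
    simp only [conjTranspose_apply, plant_inl_inl, plant_inl_inr, plant_inr_inl, plant_inr_inr] <;>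
    split_ifs <;> subst_vars <;> simp_all

/-- **`SU(1,1)` relations ⇒ `plant m ∈ U(P,Q)`**: `(plant m)ᴴ · diag(1,−1) · plant m = diag(1,−1)`.
[folklore] -/
theorem conjTranspose_plant_mul_signForm_mul_plant (m : Matrix (Fin 2) (Fin 2) ℂ)
    (h₁ : star (m 0 0) * m 0 0 - star (m 1 0) * m 1 0 = 1)
    (h₂ : star (m 0 0) * m 0 1 - star (m 1 0) * m 1 1 = 0)
    (h₃ : star (m 0 1) * m 0 0 - star (m 1 1) * m 1 0 = 0)
    (h₄ : star (m 0 1) * m 0 1 - star (m 1 1) * m 1 1 = -1) :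
    (plant p₀ q₀ m)ᴴ * signForm P Q * plant p₀ q₀ m = signForm P Q := by
  rw [plant_conjTranspose]
  refine matrix_eq_of_mulVec_eq fun x => ?_
  rw [← mulVec_mulVec, ← mulVec_mulVec]
  funext i
  rcases i with p | q
  · rw [plant_mulVec_inl, signForm_mulVec_inl]
    by_cases hp : p = p₀
    · rw [if_pos hp, hp, signForm_mulVec_inl, signForm_mulVec_inr, plant_mulVec_inl, plant_mulVec_inr,
        if_pos rfl, if_pos rfl, conjTranspose_apply, conjTranspose_apply]
      linear_combination (x (Sum.inl p₀)) * h₁ + (x (Sum.inr q₀)) * h₂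
    · rw [if_neg hp, signForm_mulVec_inl, plant_mulVec_inl, if_neg hp, signForm_mulVec_inl]
  · rw [plant_mulVec_inr, signForm_mulVec_inr]
    by_cases hq : q = q₀
    · rw [if_pos hq, hq, signForm_mulVec_inl, signForm_mulVec_inr, plant_mulVec_inl, plant_mulVec_inr,
        if_pos rfl, if_pos rfl, conjTranspose_apply, conjTranspose_apply]
      linear_combination (x (Sum.inl p₀)) * h₃ + (x (Sum.inr q₀)) * h₄
    · rw [if_neg hq, signForm_mulVec_inr, plant_mulVec_inr, if_neg hq, signForm_mulVec_inr]

/-- `plant` as a monoid homomorphism `M₂(ℂ) →* M_{P ⊕ Q}(ℂ)`. [folklore] -/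
def plantHom : Matrix (Fin 2) (Fin 2) ℂ →* Matrix (P ⊕ Q) (P ⊕ Q) ℂ where
  toFun := plant p₀ q₀
  map_one' := plant_one p₀ q₀
  map_mul' := plant_mul p₀ q₀

/-- unfolding `plantHom`. [folklore] -/
@[simp] theorem plantHom_apply (m : Matrix (Fin 2) (Fin 2) ℂ) : plantHom p₀ q₀ m = plant p₀ q₀ m := rfl

end Plant

/-! ## 3. The homomorphism `φ : SL(2,ℝ) →* U(P,Q) × U(R,S)` -/

section Phi

variable {P Q : Type*} [Fintype P] [DecidableEq P] [Fintype Q] [DecidableEq Q]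
  (R S : Type*) [Fintype R] [DecidableEq R] [Fintype S] [DecidableEq S] (p₀ : P) (q₀ : Q)

/-- `g ↦ plant (cay g)` as a homomorphism `SL(2,ℝ) →* GL(V)`. [folklore] -/
def φGL : Matrix.SpecialLinearGroup (Fin 2) ℝ →* GL (P ⊕ Q) ℂ :=
  ((plantHom p₀ q₀).comp cayHom).toHomUnits

/-- the matrix of `φGL g` is `plant (cay g)`. [folklore] -/
@[simp] theorem coe_φGL (g : Matrix.SpecialLinearGroup (Fin 2) ℝ) :
    ((φGL p₀ q₀ g : GL (P ⊕ Q) ℂ) : Matrix (P ⊕ Q) (P ⊕ Q) ℂ) = plant p₀ q₀ (cay (g : Matrix (Fin 2) (Fin 2) ℝ)) :=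
  rfl

/-- `φGL g ∈ U(P,Q)` — the planted Cayley conjugate preserves `diag(1_P, −1_Q)`. [folklore] -/
theorem φGL_mem (g : Matrix.SpecialLinearGroup (Fin 2) ℝ) :
    φGL p₀ q₀ g ∈ unitaryGroupOfForm (starRingEnd ℂ) (signForm P Q) := by
  rw [mem_unitaryGroupOfForm_star_iff_conjTranspose, coe_φGL]
  have hg := sl2_det_entries g
  exact conjTranspose_plant_mul_signForm_mul_plant p₀ q₀ _ (cay_rel₁ _ hg) (cay_rel₂ _) (cay_rel₃ _)
    (cay_rel₄ _ hg)

/-- **`φV p₀ q₀ : SL(2,ℝ) →* U(P,Q)`**, the `SU(1,1)` of the hyperbolic plane `{e_{p₀}, e_{q₀}}`. [folklore] -/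
def φV : Matrix.SpecialLinearGroup (Fin 2) ℝ →* UForm P Q :=
  (φGL p₀ q₀).codRestrict _ (φGL_mem p₀ q₀)

/-- **`φ R S p₀ q₀ : SL(2,ℝ) →* U(P,Q) × U(R,S)`**, `g ↦ (plant (cay g), 1)`. [folklore] -/
def φ : Matrix.SpecialLinearGroup (Fin 2) ℝ →* Ginf P Q R S :=
  (φV p₀ q₀).prod 1

/-- the `V`-matrix of `φ g` is `plant (cay g)`. [folklore] -/
@[simp] theorem coe_φ_fst (g : Matrix.SpecialLinearGroup (Fin 2) ℝ) :
    ((((φ R S p₀ q₀ g).1 : UForm P Q) : GL (P ⊕ Q) ℂ) : Matrix (P ⊕ Q) (P ⊕ Q) ℂ) =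
      plant p₀ q₀ (cay (g : Matrix (Fin 2) (Fin 2) ℝ)) :=
  rfl

/-- the `W`-component of `φ g` is `1`. [folklore] -/
@[simp] theorem φ_snd (g : Matrix.SpecialLinearGroup (Fin 2) ℝ) : (φ R S p₀ q₀ g).2 = 1 := rfl

/-- the `W`-matrix of `φ g` is `1`. [folklore] -/
@[simp] theorem coe_φ_snd (g : Matrix.SpecialLinearGroup (Fin 2) ℝ) :
    ((((φ R S p₀ q₀ g).2 : UForm R S) : GL (R ⊕ S) ℂ) : Matrix (R ⊕ S) (R ⊕ S) ℂ) = 1 := rfl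

/-- two elements of `U(P,Q) × U(R,S)` with the same pair of matrices are equal. [folklore] -/
theorem ginf_ext {g h : Ginf P Q R S}
    (h1 : (((g.1 : UForm P Q) : GL (P ⊕ Q) ℂ) : Matrix (P ⊕ Q) (P ⊕ Q) ℂ) =
      (((h.1 : UForm P Q) : GL (P ⊕ Q) ℂ) : Matrix (P ⊕ Q) (P ⊕ Q) ℂ))
    (h2 : (((g.2 : UForm R S) : GL (R ⊕ S) ℂ) : Matrix (R ⊕ S) (R ⊕ S) ℂ) =
      (((h.2 : UForm R S) : GL (R ⊕ S) ℂ) : Matrix (R ⊕ S) (R ⊕ S) ℂ)) : g = h :=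
  Prod.ext (Subtype.ext (Units.ext h1)) (Subtype.ext (Units.ext h2))

/-! ## 4. The compact circle: `φ (R θ) = κ (suCircle p₀ q₀ θ)` (orientation `η = 1`) -/

/-- **`hφ` of the junction pin with `η = 1`**: the rotations of this `SU(1,1)` are the `K_V`-circle
`((e^{iθ} at p₀, e^{−iθ} at q₀), (1,1))` of `JunctionVacuumCirclePin.suCircle`. [folklore] -/
theorem φ_slRot (θ : ℝ) : φ R S p₀ q₀ (slRot θ) = κ P Q R S (suCircle p₀ q₀ θ) := by
  refine ginf_ext R S ?_ ?_
  · rw [coe_φ_fst, coe_κ_fst, coe_slRot]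
    ext i j
    rcases i with p | q <;> rcases j with p' | q'
    · simp only [plant_inl_inl, suCircle, coe_diagHom, Matrix.fromBlocks_apply₁₁, Matrix.diagonal_apply,
        circleAt, Function.update_apply, cay_rot_00]
      split_ifs <;> subst_vars <;> simp_all
    · simp only [plant_inl_inr, suCircle, Matrix.fromBlocks_apply₁₂, Matrix.zero_apply, cay_rot_01, ite_self]
    · simp only [plant_inr_inl, suCircle, Matrix.fromBlocks_apply₂₁, Matrix.zero_apply, cay_rot_10, ite_self]
    · simp only [plant_inr_inr, suCircle, coe_diagHom, Matrix.fromBlocks_apply₂₂, Matrix.diagonal_apply,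
        circleAt, Function.update_apply, cay_rot_11]
      split_ifs <;> subst_vars <;> simp_all
  · rw [coe_φ_snd, coe_κ_snd]
    simp [suCircle]

end Phi

/-! ## 5. The Siegel frame -/

section Frame

variable {P Q : Type*} [Fintype P] [DecidableEq P] [Fintype Q] [DecidableEq Q]
  (R S : Type*) [Fintype R] [DecidableEq R] [Fintype S] [DecidableEq S] (p₀ : P) (q₀ : Q)

/-- **The Siegel frame** `u ∈ U(DPIdx P Q R S)` (a `√2`-free Cayley-type frame with entries in `ℤ[i]/2`; the two
scalars `(1 ± i)/2` are written in cast form `↑(1/2 : ℝ) ± ↑(1/2 : ℝ) * I` throughout):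
on the pair of complex coordinates `z₁ = (p₀, r) ∈ P × R`, `z₂ = (q₀, r) ∈ Q × R` of `𝕎 = V ⊗ W` it is
`½·!![1+i, −(1+i); 1−i, 1−i]`, on the pair `z₃ = (p₀, s) ∈ P × S`, `z₄ = (q₀, s) ∈ Q × S` it is
`½·!![1+i, 1+i; 1−i, −(1−i)]`, and it is `1` on every coordinate off the planes `{e_{p₀}, e_{q₀}} ⊗ W`.
[folklore] -/
def frame : Matrix (DPIdx P Q R S) (DPIdx P Q R S) ℂ :=
  Matrix.of fun k j =>
    match k with
    | Sum.inl (Sum.inl (p, r)) =>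
        if p = p₀ then
          (((1 / 2 : ℝ) : ℂ) + ((1 / 2 : ℝ) : ℂ) * I) * (if j = Sum.inl (Sum.inl (p₀, r)) then 1 else 0)
              - (((1 / 2 : ℝ) : ℂ) + ((1 / 2 : ℝ) : ℂ) * I) * (if j = Sum.inr (Sum.inr (q₀, r)) then 1 else 0)
        else if j = Sum.inl (Sum.inl (p, r)) then 1 else 0
    | Sum.inl (Sum.inr (q, s)) =>
        if q = q₀ then
          (((1 / 2 : ℝ) : ℂ) - ((1 / 2 : ℝ) : ℂ) * I) * (if j = Sum.inr (Sum.inl (p₀, s)) then 1 else 0)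
              - (((1 / 2 : ℝ) : ℂ) - ((1 / 2 : ℝ) : ℂ) * I) * (if j = Sum.inl (Sum.inr (q₀, s)) then 1 else 0)
        else if j = Sum.inl (Sum.inr (q, s)) then 1 else 0
    | Sum.inr (Sum.inl (p, s)) =>
        if p = p₀ then
          (((1 / 2 : ℝ) : ℂ) + ((1 / 2 : ℝ) : ℂ) * I) * (if j = Sum.inr (Sum.inl (p₀, s)) then 1 else 0)
              + (((1 / 2 : ℝ) : ℂ) + ((1 / 2 : ℝ) : ℂ) * I) * (if j = Sum.inl (Sum.inr (q₀, s)) then 1 else 0)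
        else if j = Sum.inr (Sum.inl (p, s)) then 1 else 0
    | Sum.inr (Sum.inr (q, r)) =>
        if q = q₀ then
          (((1 / 2 : ℝ) : ℂ) - ((1 / 2 : ℝ) : ℂ) * I) * (if j = Sum.inl (Sum.inl (p₀, r)) then 1 else 0)
              + (((1 / 2 : ℝ) : ℂ) - ((1 / 2 : ℝ) : ℂ) * I) * (if j = Sum.inr (Sum.inr (q₀, r)) then 1 else 0)
        else if j = Sum.inr (Sum.inr (q, r)) then 1 else 0

/-- **The adjoint frame** `uᴴ` (`= u⁻¹`), by entries: on the `R`-planes `½·!![1−i, 1+i; −(1−i), 1+i]`, on the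
`S`-planes `½·!![1−i, 1+i; 1−i, −(1+i)]`, `1` elsewhere. [folklore] -/
def frameAdj : Matrix (DPIdx P Q R S) (DPIdx P Q R S) ℂ :=
  Matrix.of fun k j =>
    match k with
    | Sum.inl (Sum.inl (p, r)) =>
        if p = p₀ then
          (((1 / 2 : ℝ) : ℂ) - ((1 / 2 : ℝ) : ℂ) * I) * (if j = Sum.inl (Sum.inl (p₀, r)) then 1 else 0)
              + (((1 / 2 : ℝ) : ℂ) + ((1 / 2 : ℝ) : ℂ) * I) * (if j = Sum.inr (Sum.inr (q₀, r)) then 1 else 0)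
        else if j = Sum.inl (Sum.inl (p, r)) then 1 else 0
    | Sum.inl (Sum.inr (q, s)) =>
        if q = q₀ then
          (((1 / 2 : ℝ) : ℂ) - ((1 / 2 : ℝ) : ℂ) * I) * (if j = Sum.inr (Sum.inl (p₀, s)) then 1 else 0)
              - (((1 / 2 : ℝ) : ℂ) + ((1 / 2 : ℝ) : ℂ) * I) * (if j = Sum.inl (Sum.inr (q₀, s)) then 1 else 0)
        else if j = Sum.inl (Sum.inr (q, s)) then 1 else 0
    | Sum.inr (Sum.inl (p, s)) =>
        if p = p₀ then
          (((1 / 2 : ℝ) : ℂ) - ((1 / 2 : ℝ) : ℂ) * I) * (if j = Sum.inr (Sum.inl (p₀, s)) then 1 else 0)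
              + (((1 / 2 : ℝ) : ℂ) + ((1 / 2 : ℝ) : ℂ) * I) * (if j = Sum.inl (Sum.inr (q₀, s)) then 1 else 0)
        else if j = Sum.inr (Sum.inl (p, s)) then 1 else 0
    | Sum.inr (Sum.inr (q, r)) =>
        if q = q₀ then
          -((((1 / 2 : ℝ) : ℂ) - ((1 / 2 : ℝ) : ℂ) * I) * (if j = Sum.inl (Sum.inl (p₀, r)) then 1 else 0))
              + (((1 / 2 : ℝ) : ℂ) + ((1 / 2 : ℝ) : ℂ) * I) * (if j = Sum.inr (Sum.inr (q₀, r)) then 1 else 0)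
        else if j = Sum.inr (Sum.inr (q, r)) then 1 else 0

variable {R S}

omit [Fintype P] [Fintype Q] [Fintype R] [Fintype S] in
/-- rows of the frame at the coordinates `(p, r) ∈ P × R`. [folklore] -/
@[simp] theorem frame_ll (p : P) (r : R) (j : DPIdx P Q R S) :
    frame R S p₀ q₀ (Sum.inl (Sum.inl (p, r))) j =
      if p = p₀ then
        (((1 / 2 : ℝ) : ℂ) + ((1 / 2 : ℝ) : ℂ) * I) * (if j = Sum.inl (Sum.inl (p₀, r)) then 1 else 0)
            - (((1 / 2 : ℝ) : ℂ) + ((1 / 2 : ℝ) : ℂ) * I) * (if j = Sum.inr (Sum.inr (q₀, r)) then 1 else 0)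
      else if j = Sum.inl (Sum.inl (p, r)) then 1 else 0 := rfl

omit [Fintype P] [Fintype Q] [Fintype R] [Fintype S] in
/-- rows of the frame at the coordinates `(q, s) ∈ Q × S`. [folklore] -/
@[simp] theorem frame_lr (q : Q) (s : S) (j : DPIdx P Q R S) :
    frame R S p₀ q₀ (Sum.inl (Sum.inr (q, s))) j =
      if q = q₀ then
        (((1 / 2 : ℝ) : ℂ) - ((1 / 2 : ℝ) : ℂ) * I) * (if j = Sum.inr (Sum.inl (p₀, s)) then 1 else 0)
            - (((1 / 2 : ℝ) : ℂ) - ((1 / 2 : ℝ) : ℂ) * I) * (if j = Sum.inl (Sum.inr (q₀, s)) then 1 else 0)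
      else if j = Sum.inl (Sum.inr (q, s)) then 1 else 0 := rfl

omit [Fintype P] [Fintype Q] [Fintype R] [Fintype S] in
/-- rows of the frame at the coordinates `(p, s) ∈ P × S`. [folklore] -/
@[simp] theorem frame_rl (p : P) (s : S) (j : DPIdx P Q R S) :
    frame R S p₀ q₀ (Sum.inr (Sum.inl (p, s))) j =
      if p = p₀ then
        (((1 / 2 : ℝ) : ℂ) + ((1 / 2 : ℝ) : ℂ) * I) * (if j = Sum.inr (Sum.inl (p₀, s)) then 1 else 0)
            + (((1 / 2 : ℝ) : ℂ) + ((1 / 2 : ℝ) : ℂ) * I) * (if j = Sum.inl (Sum.inr (q₀, s)) then 1 else 0)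
      else if j = Sum.inr (Sum.inl (p, s)) then 1 else 0 := rfl

omit [Fintype P] [Fintype Q] [Fintype R] [Fintype S] in
/-- rows of the frame at the coordinates `(q, r) ∈ Q × R`. [folklore] -/
@[simp] theorem frame_rr (q : Q) (r : R) (j : DPIdx P Q R S) :
    frame R S p₀ q₀ (Sum.inr (Sum.inr (q, r))) j =
      if q = q₀ then
        (((1 / 2 : ℝ) : ℂ) - ((1 / 2 : ℝ) : ℂ) * I) * (if j = Sum.inl (Sum.inl (p₀, r)) then 1 else 0)
            + (((1 / 2 : ℝ) : ℂ) - ((1 / 2 : ℝ) : ℂ) * I) * (if j = Sum.inr (Sum.inr (q₀, r)) then 1 else 0)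
      else if j = Sum.inr (Sum.inr (q, r)) then 1 else 0 := rfl

omit [Fintype P] [Fintype Q] [Fintype R] [Fintype S] in
/-- rows of the adjoint frame at the coordinates `(p, r) ∈ P × R`. [folklore] -/
@[simp] theorem frameAdj_ll (p : P) (r : R) (j : DPIdx P Q R S) :
    frameAdj R S p₀ q₀ (Sum.inl (Sum.inl (p, r))) j =
      if p = p₀ then
        (((1 / 2 : ℝ) : ℂ) - ((1 / 2 : ℝ) : ℂ) * I) * (if j = Sum.inl (Sum.inl (p₀, r)) then 1 else 0)
            + (((1 / 2 : ℝ) : ℂ) + ((1 / 2 : ℝ) : ℂ) * I) * (if j = Sum.inr (Sum.inr (q₀, r)) then 1 else 0)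
      else if j = Sum.inl (Sum.inl (p, r)) then 1 else 0 := rfl

omit [Fintype P] [Fintype Q] [Fintype R] [Fintype S] in
/-- rows of the adjoint frame at the coordinates `(q, s) ∈ Q × S`. [folklore] -/
@[simp] theorem frameAdj_lr (q : Q) (s : S) (j : DPIdx P Q R S) :
    frameAdj R S p₀ q₀ (Sum.inl (Sum.inr (q, s))) j =
      if q = q₀ then
        (((1 / 2 : ℝ) : ℂ) - ((1 / 2 : ℝ) : ℂ) * I) * (if j = Sum.inr (Sum.inl (p₀, s)) then 1 else 0)
            - (((1 / 2 : ℝ) : ℂ) + ((1 / 2 : ℝ) : ℂ) * I) * (if j = Sum.inl (Sum.inr (q₀, s)) then 1 else 0)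
      else if j = Sum.inl (Sum.inr (q, s)) then 1 else 0 := rfl

omit [Fintype P] [Fintype Q] [Fintype R] [Fintype S] in
/-- rows of the adjoint frame at the coordinates `(p, s) ∈ P × S`. [folklore] -/
@[simp] theorem frameAdj_rl (p : P) (s : S) (j : DPIdx P Q R S) :
    frameAdj R S p₀ q₀ (Sum.inr (Sum.inl (p, s))) j =
      if p = p₀ then
        (((1 / 2 : ℝ) : ℂ) - ((1 / 2 : ℝ) : ℂ) * I) * (if j = Sum.inr (Sum.inl (p₀, s)) then 1 else 0)
            + (((1 / 2 : ℝ) : ℂ) + ((1 / 2 : ℝ) : ℂ) * I) * (if j = Sum.inl (Sum.inr (q₀, s)) then 1 else 0)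
      else if j = Sum.inr (Sum.inl (p, s)) then 1 else 0 := rfl

omit [Fintype P] [Fintype Q] [Fintype R] [Fintype S] in
/-- rows of the adjoint frame at the coordinates `(q, r) ∈ Q × R`. [folklore] -/
@[simp] theorem frameAdj_rr (q : Q) (r : R) (j : DPIdx P Q R S) :
    frameAdj R S p₀ q₀ (Sum.inr (Sum.inr (q, r))) j =
      if q = q₀ then
        -((((1 / 2 : ℝ) : ℂ) - ((1 / 2 : ℝ) : ℂ) * I) * (if j = Sum.inl (Sum.inl (p₀, r)) then 1 else 0))
            + (((1 / 2 : ℝ) : ℂ) + ((1 / 2 : ℝ) : ℂ) * I) * (if j = Sum.inr (Sum.inr (q₀, r)) then 1 else 0)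
      else if j = Sum.inr (Sum.inr (q, r)) then 1 else 0 := rfl

/-- the frame on vectors, coordinates `(p, r)`. [folklore] -/
theorem frame_mulVec_ll (X : DPIdx P Q R S → ℂ) (p : P) (r : R) :
    (frame R S p₀ q₀ *ᵥ X) (Sum.inl (Sum.inl (p, r))) =
      if p = p₀ then (((1 / 2 : ℝ) : ℂ) + ((1 / 2 : ℝ) : ℂ) * I) * X (Sum.inl (Sum.inl (p₀, r)))
          - (((1 / 2 : ℝ) : ℂ) + ((1 / 2 : ℝ) : ℂ) * I) * X (Sum.inr (Sum.inr (q₀, r)))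
      else X (Sum.inl (Sum.inl (p, r))) := by
  simp only [mulVec, dotProduct, frame_ll]
  split_ifs with hp
  · simp only [sub_mul, mul_ite, mul_one, mul_zero, ite_mul, zero_mul, Finset.sum_sub_distrib,
      Finset.sum_ite_eq', Finset.mem_univ, if_true]
  · simp only [ite_mul, one_mul, zero_mul, Finset.sum_ite_eq', Finset.mem_univ, if_true]

/-- the frame on vectors, coordinates `(q, s)`. [folklore] -/
theorem frame_mulVec_lr (X : DPIdx P Q R S → ℂ) (q : Q) (s : S) :
    (frame R S p₀ q₀ *ᵥ X) (Sum.inl (Sum.inr (q, s))) =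
      if q = q₀ then (((1 / 2 : ℝ) : ℂ) - ((1 / 2 : ℝ) : ℂ) * I) * X (Sum.inr (Sum.inl (p₀, s)))
          - (((1 / 2 : ℝ) : ℂ) - ((1 / 2 : ℝ) : ℂ) * I) * X (Sum.inl (Sum.inr (q₀, s)))
      else X (Sum.inl (Sum.inr (q, s))) := by
  simp only [mulVec, dotProduct, frame_lr]
  split_ifs with hq
  · simp only [sub_mul, mul_ite, mul_one, mul_zero, ite_mul, zero_mul, Finset.sum_sub_distrib,
      Finset.sum_ite_eq', Finset.mem_univ, if_true]
  · simp only [ite_mul, one_mul, zero_mul, Finset.sum_ite_eq', Finset.mem_univ, if_true]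

/-- the frame on vectors, coordinates `(p, s)`. [folklore] -/
theorem frame_mulVec_rl (X : DPIdx P Q R S → ℂ) (p : P) (s : S) :
    (frame R S p₀ q₀ *ᵥ X) (Sum.inr (Sum.inl (p, s))) =
      if p = p₀ then (((1 / 2 : ℝ) : ℂ) + ((1 / 2 : ℝ) : ℂ) * I) * X (Sum.inr (Sum.inl (p₀, s)))
          + (((1 / 2 : ℝ) : ℂ) + ((1 / 2 : ℝ) : ℂ) * I) * X (Sum.inl (Sum.inr (q₀, s)))
      else X (Sum.inr (Sum.inl (p, s))) := by
  simp only [mulVec, dotProduct, frame_rl]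
  split_ifs with hp
  · simp only [add_mul, mul_ite, mul_one, mul_zero, ite_mul, zero_mul, Finset.sum_add_distrib,
      Finset.sum_ite_eq', Finset.mem_univ, if_true]
  · simp only [ite_mul, one_mul, zero_mul, Finset.sum_ite_eq', Finset.mem_univ, if_true]

/-- the frame on vectors, coordinates `(q, r)`. [folklore] -/
theorem frame_mulVec_rr (X : DPIdx P Q R S → ℂ) (q : Q) (r : R) :
    (frame R S p₀ q₀ *ᵥ X) (Sum.inr (Sum.inr (q, r))) =
      if q = q₀ then (((1 / 2 : ℝ) : ℂ) - ((1 / 2 : ℝ) : ℂ) * I) * X (Sum.inl (Sum.inl (p₀, r)))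
          + (((1 / 2 : ℝ) : ℂ) - ((1 / 2 : ℝ) : ℂ) * I) * X (Sum.inr (Sum.inr (q₀, r)))
      else X (Sum.inr (Sum.inr (q, r))) := by
  simp only [mulVec, dotProduct, frame_rr]
  split_ifs with hq
  · simp only [add_mul, mul_ite, mul_one, mul_zero, ite_mul, zero_mul, Finset.sum_add_distrib,
      Finset.sum_ite_eq', Finset.mem_univ, if_true]
  · simp only [ite_mul, one_mul, zero_mul, Finset.sum_ite_eq', Finset.mem_univ, if_true]

/-- the adjoint frame on vectors, coordinates `(p, r)`. [folklore] -/
theorem frameAdj_mulVec_ll (X : DPIdx P Q R S → ℂ) (p : P) (r : R) :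
    (frameAdj R S p₀ q₀ *ᵥ X) (Sum.inl (Sum.inl (p, r))) =
      if p = p₀ then (((1 / 2 : ℝ) : ℂ) - ((1 / 2 : ℝ) : ℂ) * I) * X (Sum.inl (Sum.inl (p₀, r)))
          + (((1 / 2 : ℝ) : ℂ) + ((1 / 2 : ℝ) : ℂ) * I) * X (Sum.inr (Sum.inr (q₀, r)))
      else X (Sum.inl (Sum.inl (p, r))) := by
  simp only [mulVec, dotProduct, frameAdj_ll]
  split_ifs with hp
  · simp only [add_mul, mul_ite, mul_one, mul_zero, ite_mul, zero_mul, Finset.sum_add_distrib,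
      Finset.sum_ite_eq', Finset.mem_univ, if_true]
  · simp only [ite_mul, one_mul, zero_mul, Finset.sum_ite_eq', Finset.mem_univ, if_true]

/-- the adjoint frame on vectors, coordinates `(q, s)`. [folklore] -/
theorem frameAdj_mulVec_lr (X : DPIdx P Q R S → ℂ) (q : Q) (s : S) :
    (frameAdj R S p₀ q₀ *ᵥ X) (Sum.inl (Sum.inr (q, s))) =
      if q = q₀ then (((1 / 2 : ℝ) : ℂ) - ((1 / 2 : ℝ) : ℂ) * I) * X (Sum.inr (Sum.inl (p₀, s)))
          - (((1 / 2 : ℝ) : ℂ) + ((1 / 2 : ℝ) : ℂ) * I) * X (Sum.inl (Sum.inr (q₀, s)))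
      else X (Sum.inl (Sum.inr (q, s))) := by
  simp only [mulVec, dotProduct, frameAdj_lr]
  split_ifs with hq
  · simp only [sub_mul, mul_ite, mul_one, mul_zero, ite_mul, zero_mul, Finset.sum_sub_distrib,
      Finset.sum_ite_eq', Finset.mem_univ, if_true]
  · simp only [ite_mul, one_mul, zero_mul, Finset.sum_ite_eq', Finset.mem_univ, if_true]

/-- the adjoint frame on vectors, coordinates `(p, s)`. [folklore] -/
theorem frameAdj_mulVec_rl (X : DPIdx P Q R S → ℂ) (p : P) (s : S) :
    (frameAdj R S p₀ q₀ *ᵥ X) (Sum.inr (Sum.inl (p, s))) =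
      if p = p₀ then (((1 / 2 : ℝ) : ℂ) - ((1 / 2 : ℝ) : ℂ) * I) * X (Sum.inr (Sum.inl (p₀, s)))
          + (((1 / 2 : ℝ) : ℂ) + ((1 / 2 : ℝ) : ℂ) * I) * X (Sum.inl (Sum.inr (q₀, s)))
      else X (Sum.inr (Sum.inl (p, s))) := by
  simp only [mulVec, dotProduct, frameAdj_rl]
  split_ifs with hp
  · simp only [add_mul, mul_ite, mul_one, mul_zero, ite_mul, zero_mul, Finset.sum_add_distrib,
      Finset.sum_ite_eq', Finset.mem_univ, if_true]
  · simp only [ite_mul, one_mul, zero_mul, Finset.sum_ite_eq', Finset.mem_univ, if_true]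

/-- the adjoint frame on vectors, coordinates `(q, r)`. [folklore] -/
theorem frameAdj_mulVec_rr (X : DPIdx P Q R S → ℂ) (q : Q) (r : R) :
    (frameAdj R S p₀ q₀ *ᵥ X) (Sum.inr (Sum.inr (q, r))) =
      if q = q₀ then -((((1 / 2 : ℝ) : ℂ) - ((1 / 2 : ℝ) : ℂ) * I) * X (Sum.inl (Sum.inl (p₀, r))))
          + (((1 / 2 : ℝ) : ℂ) + ((1 / 2 : ℝ) : ℂ) * I) * X (Sum.inr (Sum.inr (q₀, r)))
      else X (Sum.inr (Sum.inr (q, r))) := by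
  simp only [mulVec, dotProduct, frameAdj_rr]
  split_ifs with hq
  · simp only [add_mul, neg_mul, mul_ite, mul_one, mul_zero, ite_mul, zero_mul, Finset.sum_add_distrib,
      Finset.sum_neg_distrib, Finset.sum_ite_eq', Finset.mem_univ, if_true]
  · simp only [ite_mul, one_mul, zero_mul, Finset.sum_ite_eq', Finset.mem_univ, if_true]

omit [Fintype P] [Fintype Q] [Fintype R] [Fintype S] in
/-- **`uᴴ = frameAdj`** (entrywise). [folklore] -/
theorem frame_conjTranspose : (frame R S p₀ q₀)ᴴ = frameAdj R S p₀ q₀ := by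
  ext k j
  rcases k with ((⟨p, r⟩ | ⟨q, s⟩) | (⟨p, s⟩ | ⟨q, r⟩)) <;>
  rcases j with ((⟨p', r'⟩ | ⟨q', s'⟩) | (⟨p', s'⟩ | ⟨q', r'⟩)) <;>
  simp only [conjTranspose_apply, frame_ll, frame_lr, frame_rl, frame_rr, frameAdj_ll, frameAdj_lr,
    frameAdj_rl, frameAdj_rr] <;>
  split_ifs <;> simp_all <;> ring

/-- **`uᴴ u = 1`**. [folklore] -/
theorem frameAdj_mul_frame : frameAdj R S p₀ q₀ * frame R S p₀ q₀ = 1 := by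
  refine matrix_eq_of_mulVec_eq fun X => ?_
  rw [← mulVec_mulVec, one_mulVec]
  funext k
  rcases k with ((⟨p, r⟩ | ⟨q, s⟩) | (⟨p, s⟩ | ⟨q, r⟩))
  · rw [frameAdj_mulVec_ll]
    split_ifs with hp
    · subst hp
      rw [frame_mulVec_ll, frame_mulVec_rr, if_pos rfl, if_pos rfl]
      apply Complex.ext <;> simp <;> ring
    · rw [frame_mulVec_ll, if_neg hp]
  · rw [frameAdj_mulVec_lr]
    split_ifs with hq
    · subst hq
      rw [frame_mulVec_rl, frame_mulVec_lr, if_pos rfl, if_pos rfl]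
      apply Complex.ext <;> simp <;> ring
    · rw [frame_mulVec_lr, if_neg hq]
  · rw [frameAdj_mulVec_rl]
    split_ifs with hp
    · subst hp
      rw [frame_mulVec_rl, frame_mulVec_lr, if_pos rfl, if_pos rfl]
      apply Complex.ext <;> simp <;> ring
    · rw [frame_mulVec_rl, if_neg hp]
  · rw [frameAdj_mulVec_rr]
    split_ifs with hq
    · subst hq
      rw [frame_mulVec_ll, frame_mulVec_rr, if_pos rfl, if_pos rfl]
      apply Complex.ext <;> simp <;> ring
    · rw [frame_mulVec_rr, if_neg hq]

variable (R S)

/-- **The Siegel frame as an element of `U(DPIdx P Q R S)`.** [folklore] -/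
def frameU : Matrix.unitaryGroup (DPIdx P Q R S) ℂ :=
  ⟨frame R S p₀ q₀, by
    rw [Matrix.mem_unitaryGroup_iff', star_eq_conjTranspose, frame_conjTranspose, frameAdj_mul_frame]⟩

variable {R S}

/-- the matrix of `frameU`. [folklore] -/
@[simp] theorem coe_frameU :
    ((frameU R S p₀ q₀ : Matrix.unitaryGroup (DPIdx P Q R S) ℂ) : Matrix (DPIdx P Q R S) (DPIdx P Q R S) ℂ) =
      frame R S p₀ q₀ := rfl

/-- the matrix of `frameU⁻¹` is the adjoint frame. [folklore] -/
@[simp] theorem coe_frameU_inv :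
    (((frameU R S p₀ q₀)⁻¹ : Matrix.unitaryGroup (DPIdx P Q R S) ℂ) : Matrix (DPIdx P Q R S) (DPIdx P Q R S) ℂ) =
      frameAdj R S p₀ q₀ := by
  rw [Matrix.UnitaryGroup.inv_val]
  show star (frame R S p₀ q₀) = frameAdj R S p₀ q₀
  rw [star_eq_conjTranspose, frame_conjTranspose]

end Frame

/-! ## 6. The plane projection `Π` and the shear direction `b = Π_S − Π_R` -/

section Diagonal

variable {σ : Type*}

/-- a diagonal real-linear map `x ↦ (c_k x_k)_k`. [folklore] -/
def diagLin (c : σ → ℝ) : (σ → ℝ) →ₗ[ℝ] (σ → ℝ) where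
  toFun x := fun k => c k * x k
  map_add' x x' := by
    funext k
    simp only [Pi.add_apply]
    ring
  map_smul' a x := by
    funext k
    simp only [Pi.smul_apply, smul_eq_mul, RingHom.id_apply]
    ring

/-- unfolding `diagLin`. [folklore] -/
@[simp] theorem diagLin_apply (c x : σ → ℝ) (k : σ) : diagLin c x k = c k * x k := rfl

/-- a diagonal map is symmetric for the dot product. [folklore] -/
theorem dotProduct_diagLin_comm [Fintype σ] (c x x' : σ → ℝ) : x ⬝ᵥ diagLin c x' = x' ⬝ᵥ diagLin c x := by
  simp only [dotProduct, diagLin_apply]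
  exact Finset.sum_congr rfl fun k _ => by ring

/-- composition of diagonal maps. [folklore] -/
theorem diagLin_comp (c d : σ → ℝ) : diagLin c ∘ₗ diagLin d = diagLin (fun k => c k * d k) := by
  apply LinearMap.ext
  intro x
  funext k
  simp only [LinearMap.coe_comp, Function.comp_apply, diagLin_apply]
  ring

/-- the matrix of a diagonal map is the diagonal matrix. [folklore] -/
theorem toMatrix'_diagLin [Fintype σ] [DecidableEq σ] (c : σ → ℝ) : LinearMap.toMatrix' (diagLin c) = Matrix.diagonal
    c := by
  ext i j
  rw [LinearMap.toMatrix'_apply, diagLin_apply, Matrix.diagonal_apply, Pi.single_apply]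
  by_cases h : i = j
  · simp [h]
  · simp [h]

/-- trace of a diagonal map. [folklore] -/
theorem trace_toMatrix'_diagLin [Fintype σ] [DecidableEq σ] (c : σ → ℝ) : (LinearMap.toMatrix' (diagLin c)).trace = ∑
    k, c k := by
  rw [toMatrix'_diagLin, Matrix.trace_diagonal]

end Diagonal

section PlaneMaps

variable {P Q : Type*} [Fintype P] [DecidableEq P] [Fintype Q] [DecidableEq Q]
  (R S : Type*) [Fintype R] [DecidableEq R] [Fintype S] [DecidableEq S] (p₀ : P) (q₀ : Q)

/-- indicator of the `2(|R| + |S|)` real coordinates of the planes `{e_{p₀}, e_{q₀}} ⊗ W`. [folklore] -/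
def planeInd : DPIdx P Q R S → ℝ
  | Sum.inl (Sum.inl (p, _)) => if p = p₀ then 1 else 0
  | Sum.inl (Sum.inr (q, _)) => if q = q₀ then 1 else 0
  | Sum.inr (Sum.inl (p, _)) => if p = p₀ then 1 else 0
  | Sum.inr (Sum.inr (q, _)) => if q = q₀ then 1 else 0

/-- the shear sign: `−1` on the `R`-plane coordinates `(p₀, r)`, `(q₀, r)`, `+1` on the `S`-plane coordinates
`(p₀, s)`, `(q₀, s)`, `0` off the planes. [folklore] -/
def shearSign : DPIdx P Q R S → ℝ
  | Sum.inl (Sum.inl (p, _)) => if p = p₀ then -1 else 0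
  | Sum.inl (Sum.inr (q, _)) => if q = q₀ then 1 else 0
  | Sum.inr (Sum.inl (p, _)) => if p = p₀ then 1 else 0
  | Sum.inr (Sum.inr (q, _)) => if q = q₀ then -1 else 0

variable {R S}

omit [Fintype P] [Fintype Q] [Fintype R] [DecidableEq R] [Fintype S] [DecidableEq S] in
/-- values of `planeInd`. [folklore] -/
@[simp] theorem planeInd_ll (p : P) (r : R) :
    planeInd R S p₀ q₀ (Sum.inl (Sum.inl (p, r))) = if p = p₀ then 1 else 0 := rfl
omit [Fintype P] [Fintype Q] [Fintype R] [DecidableEq R] [Fintype S] [DecidableEq S] in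
/-- values of `planeInd`. [folklore] -/
@[simp] theorem planeInd_lr (q : Q) (s : S) :
    planeInd R S p₀ q₀ (Sum.inl (Sum.inr (q, s))) = if q = q₀ then 1 else 0 := rfl
omit [Fintype P] [Fintype Q] [Fintype R] [DecidableEq R] [Fintype S] [DecidableEq S] in
/-- values of `planeInd`. [folklore] -/
@[simp] theorem planeInd_rl (p : P) (s : S) :
    planeInd R S p₀ q₀ (Sum.inr (Sum.inl (p, s))) = if p = p₀ then 1 else 0 := rfl
omit [Fintype P] [Fintype Q] [Fintype R] [DecidableEq R] [Fintype S] [DecidableEq S] in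
/-- values of `planeInd`. [folklore] -/
@[simp] theorem planeInd_rr (q : Q) (r : R) :
    planeInd R S p₀ q₀ (Sum.inr (Sum.inr (q, r))) = if q = q₀ then 1 else 0 := rfl
omit [Fintype P] [Fintype Q] [Fintype R] [DecidableEq R] [Fintype S] [DecidableEq S] in
/-- values of `shearSign`. [folklore] -/
@[simp] theorem shearSign_ll (p : P) (r : R) :
    shearSign R S p₀ q₀ (Sum.inl (Sum.inl (p, r))) = if p = p₀ then -1 else 0 := rfl
omit [Fintype P] [Fintype Q] [Fintype R] [DecidableEq R] [Fintype S] [DecidableEq S] in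
/-- values of `shearSign`. [folklore] -/
@[simp] theorem shearSign_lr (q : Q) (s : S) :
    shearSign R S p₀ q₀ (Sum.inl (Sum.inr (q, s))) = if q = q₀ then 1 else 0 := rfl
omit [Fintype P] [Fintype Q] [Fintype R] [DecidableEq R] [Fintype S] [DecidableEq S] in
/-- values of `shearSign`. [folklore] -/
@[simp] theorem shearSign_rl (p : P) (s : S) :
    shearSign R S p₀ q₀ (Sum.inr (Sum.inl (p, s))) = if p = p₀ then 1 else 0 := rfl
omit [Fintype P] [Fintype Q] [Fintype R] [DecidableEq R] [Fintype S] [DecidableEq S] in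
/-- values of `shearSign`. [folklore] -/
@[simp] theorem shearSign_rr (q : Q) (r : R) :
    shearSign R S p₀ q₀ (Sum.inr (Sum.inr (q, r))) = if q = q₀ then -1 else 0 := rfl

variable (R S)

/-- **`Π = planeProj`**: the coordinate projection onto the plane coordinates. [folklore] -/
def planeProj : (DPIdx P Q R S → ℝ) →ₗ[ℝ] (DPIdx P Q R S → ℝ) := diagLin (planeInd R S p₀ q₀)

/-- **`b = shearDir = Π_S − Π_R`**: the symmetric matrix of the Siegel unipotent `ι𝕎 (φ L(y))` in the frame.
[folklore] -/
def shearDir : (DPIdx P Q R S → ℝ) →ₗ[ℝ] (DPIdx P Q R S → ℝ) := diagLin (shearSign R S p₀ q₀)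

variable {R S}

omit [Fintype P] [Fintype Q] [Fintype R] [DecidableEq R] [Fintype S] [DecidableEq S] in
/-- unfolding `planeProj`. [folklore] -/
@[simp] theorem planeProj_apply (x : DPIdx P Q R S → ℝ) (k : DPIdx P Q R S) :
    planeProj R S p₀ q₀ x k = planeInd R S p₀ q₀ k * x k := rfl

omit [Fintype P] [Fintype Q] [Fintype R] [DecidableEq R] [Fintype S] [DecidableEq S] in
/-- unfolding `shearDir`. [folklore] -/
@[simp] theorem shearDir_apply (x : DPIdx P Q R S → ℝ) (k : DPIdx P Q R S) :
    shearDir R S p₀ q₀ x k = shearSign R S p₀ q₀ k * x k := rfl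

omit [DecidableEq R] [DecidableEq S] in
/-- `b` is symmetric (`hb`). [folklore] -/
theorem dotProduct_shearDir_comm (x x' : DPIdx P Q R S → ℝ) :
    x ⬝ᵥ shearDir R S p₀ q₀ x' = x' ⬝ᵥ shearDir R S p₀ q₀ x :=
  dotProduct_diagLin_comm _ x x'

omit [DecidableEq R] [DecidableEq S] in
/-- `Π` is symmetric (`hPj`). [folklore] -/
theorem dotProduct_planeProj_comm (x x' : DPIdx P Q R S → ℝ) :
    x ⬝ᵥ planeProj R S p₀ q₀ x' = x' ⬝ᵥ planeProj R S p₀ q₀ x :=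
  dotProduct_diagLin_comm _ x x'

omit [Fintype P] [Fintype Q] [Fintype R] [DecidableEq R] [Fintype S] [DecidableEq S] in
/-- `Π² = Π` (`hPj2`). [folklore] -/
theorem planeProj_comp_planeProj : planeProj R S p₀ q₀ ∘ₗ planeProj R S p₀ q₀ = planeProj R S p₀ q₀ := by
  rw [planeProj, diagLin_comp]
  congr 1
  funext k
  rcases k with ((⟨p, r⟩ | ⟨q, s⟩) | (⟨p, s⟩ | ⟨q, r⟩)) <;> simp only [planeInd_ll, planeInd_lr, planeInd_rl,
      planeInd_rr] <;>
    split_ifs <;> norm_num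

omit [Fintype P] [Fintype Q] [Fintype R] [DecidableEq R] [Fintype S] [DecidableEq S] in
/-- `b Π = b` (`hbPj`). [folklore] -/
theorem shearDir_comp_planeProj : shearDir R S p₀ q₀ ∘ₗ planeProj R S p₀ q₀ = shearDir R S p₀ q₀ := by
  rw [shearDir, planeProj, diagLin_comp]
  congr 1
  funext k
  rcases k with ((⟨p, r⟩ | ⟨q, s⟩) | (⟨p, s⟩ | ⟨q, r⟩)) <;>
    simp only [planeInd_ll, planeInd_lr, planeInd_rl, planeInd_rr, shearSign_ll, shearSign_lr, shearSign_rl,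
      shearSign_rr] <;> split_ifs <;> norm_num

omit [Fintype P] [Fintype Q] [Fintype R] [DecidableEq R] [Fintype S] [DecidableEq S] in
/-- `Π b = b` (`hPjb`). [folklore] -/
theorem planeProj_comp_shearDir : planeProj R S p₀ q₀ ∘ₗ shearDir R S p₀ q₀ = shearDir R S p₀ q₀ := by
  rw [shearDir, planeProj, diagLin_comp]
  congr 1
  funext k
  rcases k with ((⟨p, r⟩ | ⟨q, s⟩) | (⟨p, s⟩ | ⟨q, r⟩)) <;>
    simp only [planeInd_ll, planeInd_lr, planeInd_rl, planeInd_rr, shearSign_ll, shearSign_lr, shearSign_rl,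
      shearSign_rr] <;> split_ifs <;> norm_num

/-- **`tr b = 2(|S| − |R|)`**. [folklore] -/
theorem trace_toMatrix'_shearDir :
    (LinearMap.toMatrix' (shearDir R S p₀ q₀)).trace = 2 * ((Fintype.card S : ℝ) - Fintype.card R) := by
  rw [shearDir, trace_toMatrix'_diagLin]
  simp only [Fintype.sum_sum_type, Fintype.sum_prod_type, shearSign_ll, shearSign_lr, shearSign_rl, shearSign_rr,
    Finset.sum_const, Finset.card_univ, nsmul_eq_mul, mul_ite, mul_neg, mul_one, mul_zero, Finset.sum_ite_eq',
    Finset.mem_univ, if_true]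
  ring

end PlaneMaps

/-! ## 7. The frame identities for `L(y)` and `D(½)` -/

section Identities

variable {P Q : Type*} [Fintype P] [DecidableEq P] [Fintype Q] [DecidableEq Q]
  (R S : Type*) [Fintype R] [DecidableEq R] [Fintype S] [DecidableEq S] (p₀ : P) (q₀ : Q)

variable {R S p₀ q₀}

omit [Fintype P] [DecidableEq P] [Fintype Q] [DecidableEq Q] [Fintype R] [DecidableEq R] [Fintype S] [DecidableEq S]
    in
/-- forward values of `dpEquiv`. [folklore] -/
@[simp] theorem dpEquiv_inl_inl (p : P) (r : R) :
    dpEquiv P Q R S (Sum.inl p, Sum.inl r) = Sum.inl (Sum.inl (p, r)) := rfl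
omit [Fintype P] [DecidableEq P] [Fintype Q] [DecidableEq Q] [Fintype R] [DecidableEq R] [Fintype S] [DecidableEq S]
    in
/-- forward values of `dpEquiv`. [folklore] -/
@[simp] theorem dpEquiv_inr_inr (q : Q) (s : S) :
    dpEquiv P Q R S (Sum.inr q, Sum.inr s) = Sum.inl (Sum.inr (q, s)) := rfl
omit [Fintype P] [DecidableEq P] [Fintype Q] [DecidableEq Q] [Fintype R] [DecidableEq R] [Fintype S] [DecidableEq S]
    in
/-- forward values of `dpEquiv`. [folklore] -/
@[simp] theorem dpEquiv_inl_inr (p : P) (s : S) :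
    dpEquiv P Q R S (Sum.inl p, Sum.inr s) = Sum.inr (Sum.inl (p, s)) := rfl
omit [Fintype P] [DecidableEq P] [Fintype Q] [DecidableEq Q] [Fintype R] [DecidableEq R] [Fintype S] [DecidableEq S]
    in
/-- forward values of `dpEquiv`. [folklore] -/
@[simp] theorem dpEquiv_inr_inl (q : Q) (r : R) :
    dpEquiv P Q R S (Sum.inr q, Sum.inl r) = Sum.inr (Sum.inr (q, r)) := rfl

variable (p₀ q₀)

/-- `(plant m ⊗ 1)` in the `DPIdx` frame on vectors, coordinates `(p, r)`. [folklore] -/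
theorem big_mulVec_ll (m : Matrix (Fin 2) (Fin 2) ℂ) (Y : DPIdx P Q R S → ℂ) (p : P) (r : R) :
    (Matrix.reindex (dpEquiv P Q R S) (dpEquiv P Q R S) (plant p₀ q₀ m ⊗ₖ (1 : Matrix (R ⊕ S) (R ⊕ S) ℂ)) *ᵥ Y)
        (Sum.inl (Sum.inl (p, r))) =
      if p = p₀ then m 0 0 * Y (Sum.inl (Sum.inl (p₀, r))) + m 0 1 * Y (Sum.inr (Sum.inr (q₀, r)))
      else Y (Sum.inl (Sum.inl (p, r))) := by
  rw [reindex_mulVec, Function.comp_apply, dpEquiv_symm_inl_inl, kronecker_one_mulVec, plant_mulVec_inl]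
  rfl

/-- `(plant m ⊗ 1)` on vectors, coordinates `(q, s)`. [folklore] -/
theorem big_mulVec_lr (m : Matrix (Fin 2) (Fin 2) ℂ) (Y : DPIdx P Q R S → ℂ) (q : Q) (s : S) :
    (Matrix.reindex (dpEquiv P Q R S) (dpEquiv P Q R S) (plant p₀ q₀ m ⊗ₖ (1 : Matrix (R ⊕ S) (R ⊕ S) ℂ)) *ᵥ Y)
        (Sum.inl (Sum.inr (q, s))) =
      if q = q₀ then m 1 0 * Y (Sum.inr (Sum.inl (p₀, s))) + m 1 1 * Y (Sum.inl (Sum.inr (q₀, s)))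
      else Y (Sum.inl (Sum.inr (q, s))) := by
  rw [reindex_mulVec, Function.comp_apply, dpEquiv_symm_inl_inr, kronecker_one_mulVec, plant_mulVec_inr]
  rfl

/-- `(plant m ⊗ 1)` on vectors, coordinates `(p, s)`. [folklore] -/
theorem big_mulVec_rl (m : Matrix (Fin 2) (Fin 2) ℂ) (Y : DPIdx P Q R S → ℂ) (p : P) (s : S) :
    (Matrix.reindex (dpEquiv P Q R S) (dpEquiv P Q R S) (plant p₀ q₀ m ⊗ₖ (1 : Matrix (R ⊕ S) (R ⊕ S) ℂ)) *ᵥ Y)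
        (Sum.inr (Sum.inl (p, s))) =
      if p = p₀ then m 0 0 * Y (Sum.inr (Sum.inl (p₀, s))) + m 0 1 * Y (Sum.inl (Sum.inr (q₀, s)))
      else Y (Sum.inr (Sum.inl (p, s))) := by
  rw [reindex_mulVec, Function.comp_apply, dpEquiv_symm_inr_inl, kronecker_one_mulVec, plant_mulVec_inl]
  rfl

/-- `(plant m ⊗ 1)` on vectors, coordinates `(q, r)`. [folklore] -/
theorem big_mulVec_rr (m : Matrix (Fin 2) (Fin 2) ℂ) (Y : DPIdx P Q R S → ℂ) (q : Q) (r : R) :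
    (Matrix.reindex (dpEquiv P Q R S) (dpEquiv P Q R S) (plant p₀ q₀ m ⊗ₖ (1 : Matrix (R ⊕ S) (R ⊕ S) ℂ)) *ᵥ Y)
        (Sum.inr (Sum.inr (q, r))) =
      if q = q₀ then m 1 0 * Y (Sum.inl (Sum.inl (p₀, r))) + m 1 1 * Y (Sum.inr (Sum.inr (q₀, r)))
      else Y (Sum.inr (Sum.inr (q, r))) := by
  rw [reindex_mulVec, Function.comp_apply, dpEquiv_symm_inr_inr, kronecker_one_mulVec, plant_mulVec_inr]
  rfl

/-- the Cayley conjugate of the lower shear: `cay L(y) = !![1 + iy/2, y/2; y/2, 1 − iy/2]`, entry `(0,0)`.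
[folklore] -/
theorem cay_lowerShear_00 (y : ℝ) : cay (lowerShear y) 0 0 = 1 + ((y / 2 : ℝ) : ℂ) * I := by
  apply Complex.ext <;> simp [cay, RotationThreeShears.lowerShear]
/-- entry `(0,1)` of `cay L(y)`. [folklore] -/
theorem cay_lowerShear_01 (y : ℝ) : cay (lowerShear y) 0 1 = ((y / 2 : ℝ) : ℂ) := by
  apply Complex.ext <;> simp [cay, RotationThreeShears.lowerShear]
/-- entry `(1,0)` of `cay L(y)`. [folklore] -/
theorem cay_lowerShear_10 (y : ℝ) : cay (lowerShear y) 1 0 = ((y / 2 : ℝ) : ℂ) := by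
  apply Complex.ext <;> simp [cay, RotationThreeShears.lowerShear]
/-- entry `(1,1)` of `cay L(y)`. [folklore] -/
theorem cay_lowerShear_11 (y : ℝ) : cay (lowerShear y) 1 1 = 1 - ((y / 2 : ℝ) : ℂ) * I := by
  apply Complex.ext <;> simp [cay, RotationThreeShears.lowerShear]
  ring

/-- the Cayley conjugate of `D(½) = diag(½, 2)`: `cay D(½) = !![5/4, 3i/4; −3i/4, 5/4]`, entry `(0,0)`. [folklore] -/
theorem cay_diagHalf_00 : cay !![(2⁻¹ : ℝ), 0; 0, 2⁻¹⁻¹] 0 0 = ((5 / 4 : ℝ) : ℂ) := by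
  apply Complex.ext <;> simp [cay]
  norm_num
/-- entry `(0,1)` of `cay D(½)`. [folklore] -/
theorem cay_diagHalf_01 : cay !![(2⁻¹ : ℝ), 0; 0, 2⁻¹⁻¹] 0 1 = ((3 / 4 : ℝ) : ℂ) * I := by
  apply Complex.ext <;> simp [cay]
  norm_num
/-- entry `(1,0)` of `cay D(½)`. [folklore] -/
theorem cay_diagHalf_10 : cay !![(2⁻¹ : ℝ), 0; 0, 2⁻¹⁻¹] 1 0 = ((-3 / 4 : ℝ) : ℂ) * I := by
  apply Complex.ext <;> simp [cay]
  norm_num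
/-- entry `(1,1)` of `cay D(½)`. [folklore] -/
theorem cay_diagHalf_11 : cay !![(2⁻¹ : ℝ), 0; 0, 2⁻¹⁻¹] 1 1 = ((5 / 4 : ℝ) : ℂ) := by
  apply Complex.ext <;> simp [cay]
  norm_num

/-- composition in the symplectic group is composition of maps. [folklore] -/
theorem sp_mul_mul_apply {σ : Type*} [Fintype σ] [DecidableEq σ] (A B C : symplecticGroup (polar (dotPairing σ)))
    (w : (σ → ℝ) × (σ → ℝ)) :
    ((A * B * C).1 : ((σ → ℝ) × (σ → ℝ)) ≃ₗ[ℝ] ((σ → ℝ) × (σ → ℝ))) w =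
      (A.1 : ((σ → ℝ) × (σ → ℝ)) ≃ₗ[ℝ] ((σ → ℝ) × (σ → ℝ)))
        ((B.1 : ((σ → ℝ) × (σ → ℝ)) ≃ₗ[ℝ] ((σ → ℝ) × (σ → ℝ)))
          ((C.1 : ((σ → ℝ) × (σ → ℝ)) ≃ₗ[ℝ] ((σ → ℝ) × (σ → ℝ))) w)) := rfl

variable (R S)

/-- the conjugated action in the frame, reduced to matrices: for `g ∈ SL(2,ℝ)`,
`phasePt` of `(u ι𝕎(φ g) u⁻¹)(p,q)` is `u · twMulVec (plant (cay g) ⊗ 1) (uᴴ (p + iq))`. [folklore] -/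
theorem phasePt_frame_conj (g : Matrix.SpecialLinearGroup (Fin 2) ℝ) (p q : DPIdx P Q R S → ℝ) :
    phasePt
        ((realifySp (DPIdx P Q R S) (frameU R S p₀ q₀) * (junction P Q R S).ι𝕎 (φ R S p₀ q₀ g) *
            (realifySp (DPIdx P Q R S) (frameU R S p₀ q₀))⁻¹).1 (p, q)).1
        ((realifySp (DPIdx P Q R S) (frameU R S p₀ q₀) * (junction P Q R S).ι𝕎 (φ R S p₀ q₀ g) *
            (realifySp (DPIdx P Q R S) (frameU R S p₀ q₀))⁻¹).1 (p, q)).2 =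
      frame R S p₀ q₀ *ᵥ
        twMulVec (Matrix.reindex (dpEquiv P Q R S) (dpEquiv P Q R S)
            (plant p₀ q₀ (cay (g : Matrix (Fin 2) (Fin 2) ℝ)) ⊗ₖ (1 : Matrix (R ⊕ S) (R ⊕ S) ℂ)))
          (frameAdj R S p₀ q₀ *ᵥ phasePt p q) := by
  rw [← map_inv, sp_mul_mul_apply, coe_realifySp, phasePt_realify, junction_ι𝕎, phasePt_ι𝕎, coe_realifySp,
    phasePt_realify, coe_frameU, coe_frameU_inv, coe_φ_fst, coe_φ_snd]

/-- **`hιu`: in the frame, `ι𝕎 (φ L(y))` is the Siegel unipotent `(p, q) ↦ (p, q + y·b p)`**, `b = Π_S − Π_R`.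
[folklore] -/
theorem frame_ιφ_slLower (y : ℝ) (p q : DPIdx P Q R S → ℝ) :
    (realifySp (DPIdx P Q R S) (frameU R S p₀ q₀) * (junction P Q R S).ι𝕎 (φ R S p₀ q₀ (slLower y)) *
        (realifySp (DPIdx P Q R S) (frameU R S p₀ q₀))⁻¹).1 (p, q) =
      (p, q + (y • shearDir R S p₀ q₀) p) := by
  apply pv_ext
  rw [phasePt_frame_conj, coe_slLower]
  funext k
  rcases k with ((⟨p', r⟩ | ⟨q', s⟩) | (⟨p', s⟩ | ⟨q', r⟩))
  · rw [frame_mulVec_ll]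
    by_cases hp : p' = p₀
    · subst hp
      simp only [if_true, twMulVec, tw_inl, tw_inr, big_mulVec_ll, big_mulVec_rr, frameAdj_mulVec_ll,
        frameAdj_mulVec_rr, cay_lowerShear_00, cay_lowerShear_01, cay_lowerShear_10,
        cay_lowerShear_11, phasePt_apply, Pi.add_apply, LinearMap.smul_apply, Pi.smul_apply, smul_eq_mul,
        shearDir_apply, shearSign_ll, Complex.star_def, map_add, map_sub, map_mul, map_one, Complex.conj_ofReal,
        Complex.conj_I]
      apply Complex.ext <;> simp <;> ring
    · simp only [hp, if_false, twMulVec, tw_inl, big_mulVec_ll, frameAdj_mulVec_ll, star_star, phasePt_apply,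
        Pi.add_apply, LinearMap.smul_apply, Pi.smul_apply, smul_eq_mul, shearDir_apply, shearSign_ll]
      push_cast
      ring
  · rw [frame_mulVec_lr]
    by_cases hq : q' = q₀
    · subst hq
      simp only [if_true, twMulVec, tw_inl, tw_inr, big_mulVec_rl, big_mulVec_lr, frameAdj_mulVec_rl,
        frameAdj_mulVec_lr, cay_lowerShear_00, cay_lowerShear_01, cay_lowerShear_10,
        cay_lowerShear_11, phasePt_apply, Pi.add_apply, LinearMap.smul_apply, Pi.smul_apply, smul_eq_mul,
        shearDir_apply, shearSign_lr, Complex.star_def, map_add, map_sub, map_mul, map_one, Complex.conj_ofReal,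
        Complex.conj_I]
      apply Complex.ext <;> simp <;> ring
    · simp only [hq, if_false, twMulVec, tw_inl, big_mulVec_lr, frameAdj_mulVec_lr, star_star, phasePt_apply,
        Pi.add_apply, LinearMap.smul_apply, Pi.smul_apply, smul_eq_mul, shearDir_apply, shearSign_lr]
      push_cast
      ring
  · rw [frame_mulVec_rl]
    by_cases hp : p' = p₀
    · subst hp
      simp only [if_true, twMulVec, tw_inl, tw_inr, big_mulVec_rl, big_mulVec_lr, frameAdj_mulVec_rl,
        frameAdj_mulVec_lr, cay_lowerShear_00, cay_lowerShear_01, cay_lowerShear_10,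
        cay_lowerShear_11, phasePt_apply, Pi.add_apply, LinearMap.smul_apply, Pi.smul_apply, smul_eq_mul,
        shearDir_apply, shearSign_rl, Complex.star_def, map_add, map_sub, map_mul, map_one, Complex.conj_ofReal,
        Complex.conj_I]
      apply Complex.ext <;> simp <;> ring
    · simp only [hp, if_false, twMulVec, tw_inr, big_mulVec_rl, frameAdj_mulVec_rl, phasePt_apply,
        Pi.add_apply, LinearMap.smul_apply, Pi.smul_apply, smul_eq_mul, shearDir_apply, shearSign_rl]
      push_cast
      ring
  · rw [frame_mulVec_rr]
    by_cases hq : q' = q₀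
    · subst hq
      simp only [if_true, twMulVec, tw_inl, tw_inr, big_mulVec_ll, big_mulVec_rr, frameAdj_mulVec_ll,
        frameAdj_mulVec_rr, cay_lowerShear_00, cay_lowerShear_01, cay_lowerShear_10,
        cay_lowerShear_11, phasePt_apply, Pi.add_apply, LinearMap.smul_apply, Pi.smul_apply, smul_eq_mul,
        shearDir_apply, shearSign_rr, Complex.star_def, map_add, map_sub, map_mul, map_one, Complex.conj_ofReal,
        Complex.conj_I]
      apply Complex.ext <;> simp <;> ring
    · simp only [hq, if_false, twMulVec, tw_inr, big_mulVec_rr, frameAdj_mulVec_rr, phasePt_apply,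
        Pi.add_apply, LinearMap.smul_apply, Pi.smul_apply, smul_eq_mul, shearDir_apply, shearSign_rr]
      push_cast
      ring

/-- **`hιd`: in the frame, `ι𝕎 (φ D(½))` is `(p, q) ↦ (p − ½Πp, q + Πq)`.** [folklore] -/
theorem frame_ιφ_slDiag_half (p q : DPIdx P Q R S → ℝ) :
    (realifySp (DPIdx P Q R S) (frameU R S p₀ q₀) *
          (junction P Q R S).ι𝕎 (φ R S p₀ q₀ (slDiag 2⁻¹ (inv_ne_zero two_ne_zero))) *
        (realifySp (DPIdx P Q R S) (frameU R S p₀ q₀))⁻¹).1 (p, q) =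
      (p - (2⁻¹ : ℝ) • planeProj R S p₀ q₀ p, q + planeProj R S p₀ q₀ q) := by
  apply pv_ext
  rw [phasePt_frame_conj, coe_slDiag]
  funext k
  rcases k with ((⟨p', r⟩ | ⟨q', s⟩) | (⟨p', s⟩ | ⟨q', r⟩))
  · rw [frame_mulVec_ll]
    by_cases hp : p' = p₀
    · subst hp
      simp only [if_true, twMulVec, tw_inl, tw_inr, big_mulVec_ll, big_mulVec_rr, frameAdj_mulVec_ll,
        frameAdj_mulVec_rr, cay_diagHalf_00, cay_diagHalf_01, cay_diagHalf_10, cay_diagHalf_11,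
        phasePt_apply, Pi.add_apply, Pi.sub_apply, Pi.smul_apply, smul_eq_mul, planeProj_apply, planeInd_ll,
        Complex.star_def, map_add, map_sub, map_mul, map_neg, Complex.conj_ofReal, Complex.conj_I]
      apply Complex.ext <;> simp <;> ring
    · simp only [hp, if_false, twMulVec, tw_inl, big_mulVec_ll, frameAdj_mulVec_ll, star_star, phasePt_apply,
        Pi.add_apply, Pi.sub_apply, Pi.smul_apply, smul_eq_mul, planeProj_apply, planeInd_ll]
      push_cast
      ring
  · rw [frame_mulVec_lr]
    by_cases hq : q' = q₀
    · subst hq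
      simp only [if_true, twMulVec, tw_inl, tw_inr, big_mulVec_rl, big_mulVec_lr, frameAdj_mulVec_rl,
        frameAdj_mulVec_lr, cay_diagHalf_00, cay_diagHalf_01, cay_diagHalf_10, cay_diagHalf_11,
        phasePt_apply, Pi.add_apply, Pi.sub_apply, Pi.smul_apply, smul_eq_mul, planeProj_apply, planeInd_lr,
        Complex.star_def, map_add, map_sub, map_mul, map_neg, Complex.conj_ofReal, Complex.conj_I]
      apply Complex.ext <;> simp <;> ring
    · simp only [hq, if_false, twMulVec, tw_inl, big_mulVec_lr, frameAdj_mulVec_lr, star_star, phasePt_apply,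
        Pi.add_apply, Pi.sub_apply, Pi.smul_apply, smul_eq_mul, planeProj_apply, planeInd_lr]
      push_cast
      ring
  · rw [frame_mulVec_rl]
    by_cases hp : p' = p₀
    · subst hp
      simp only [if_true, twMulVec, tw_inl, tw_inr, big_mulVec_rl, big_mulVec_lr, frameAdj_mulVec_rl,
        frameAdj_mulVec_lr, cay_diagHalf_00, cay_diagHalf_01, cay_diagHalf_10, cay_diagHalf_11,
        phasePt_apply, Pi.add_apply, Pi.sub_apply, Pi.smul_apply, smul_eq_mul, planeProj_apply,
        planeInd_rl, Complex.star_def, map_add, map_sub, map_mul, map_neg, Complex.conj_ofReal, Complex.conj_I]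
      apply Complex.ext <;> simp <;> ring
    · simp only [hp, if_false, twMulVec, tw_inr, big_mulVec_rl, frameAdj_mulVec_rl, phasePt_apply, Pi.add_apply,
        Pi.sub_apply, Pi.smul_apply, smul_eq_mul, planeProj_apply, planeInd_rl]
      push_cast
      ring
  · rw [frame_mulVec_rr]
    by_cases hq : q' = q₀
    · subst hq
      simp only [if_true, twMulVec, tw_inl, tw_inr, big_mulVec_ll, big_mulVec_rr, frameAdj_mulVec_ll,
        frameAdj_mulVec_rr, cay_diagHalf_00, cay_diagHalf_01, cay_diagHalf_10, cay_diagHalf_11,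
        phasePt_apply, Pi.add_apply, Pi.sub_apply, Pi.smul_apply, smul_eq_mul, planeProj_apply,
        planeInd_rr, Complex.star_def, map_add, map_sub, map_mul, map_neg, Complex.conj_ofReal, Complex.conj_I]
      apply Complex.ext <;> simp <;> ring
    · simp only [hq, if_false, twMulVec, tw_inr, big_mulVec_rr, frameAdj_mulVec_rr, phasePt_apply, Pi.add_apply,
        Pi.sub_apply, Pi.smul_apply, smul_eq_mul, planeProj_apply, planeInd_rr]
      push_cast
      ring

end Identities

/-! ## 8. Conclusion: the zero-point pin for the real unitary dual pair -/

section Conclusion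

variable {P Q : Type*} [Fintype P] [DecidableEq P] [Fintype Q] [DecidableEq Q]
  {R S : Type*} [Fintype R] [DecidableEq R] [Fintype S] [DecidableEq S]

/-- **Zero-point pin, real unitary dual pair, signed form**: for every vacuum character with exponents `e`
over the junction `RealDualPair.junction P Q R S` and every hyperbolic plane `(p₀, q₀)` of `V`:
`2(e_P − e_Q) = 2(|R| − |S|)` — zp2d §5 (`η = 1`, `φ`, `u`, `b`, `Π` of this file) with `−tr b = 2(|R| − |S|)`.
[folklore] -/
theorem two_mul_eP_sub_eQ {e : VacExponents} (h : (junction P Q R S).FockVacuumCharacter e) (p₀ : P) (q₀ : Q) :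
    (2 : ℝ) * ((e.eP - e.eQ : ℤ) : ℝ) = 2 * ((Fintype.card R : ℝ) - Fintype.card S) := by
  have key := h.two_mul_zmul_eP_sub_eQ_eq_neg_trace_of_absorb (φ R S p₀ q₀) p₀ q₀ 1
    (fun θ => by rw [junction_κ, Int.cast_one, one_mul]; exact φ_slRot R S p₀ q₀ θ) (frameU R S p₀ q₀)
    (dotProduct_shearDir_comm p₀ q₀) (dotProduct_planeProj_comm p₀ q₀) (planeProj_comp_planeProj p₀ q₀)
    (shearDir_comp_planeProj p₀ q₀) (planeProj_comp_shearDir p₀ q₀) (frame_ιφ_slLower R S p₀ q₀)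
    (frame_ιφ_slDiag_half R S p₀ q₀)
  rw [trace_toMatrix'_shearDir, one_mul] at key
  linarith

/-- **Zero-point pin, real unitary dual pair**: `e_P − e_Q = |R| − |S|` — the correlation of the two
determinant-power exponents of a vacuum character over `U(P,Q) × U(R,S)` (KK07 (3.1) / Kashiwara–Vergne:
`K_V` acts on the vacuum through `det^{(|R|−|S|)/2}`-type powers whose `P`/`Q` exponents differ by `|R| − |S|`),
valid as soon as `V` is indefinite (`P`, `Q` nonempty). [folklore] -/
theorem eP_sub_eQ {e : VacExponents} (h : (junction P Q R S).FockVacuumCharacter e) (p₀ : P) (q₀ : Q) :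
    e.eP - e.eQ = (Fintype.card R : ℤ) - Fintype.card S := by
  have key := two_mul_eP_sub_eQ h p₀ q₀
  have key' : ((e.eP - e.eQ : ℤ) : ℝ) = (((Fintype.card R : ℤ) - Fintype.card S : ℤ) : ℝ) := by
    push_cast at key ⊢
    linarith
  exact_mod_cast key'

end Conclusion

end RealDualPair

end Literature.RepresentationTheory.KonnoKonno2007

end
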